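import Summits.BirchSwinnertonDyer.BirchSwinnertonDyer.Theorems.AdditiveBranchIMCGordTwoRankZeroDesc3DoorTamDefect
import Summits.BirchSwinnertonDyer.Rank1Residual.Additive.JValuationOfIntModel
import HarnessLib

/-!
# Route `AdditiveBranchIMC` (rung K1), crux `GordTwoRankZeroOffCaseOne` (item 19357): the X4♯(3) desc3 doors in `_of_lower` form + a kernel `j`-WITNESS tool
# (cell `bsd-addord`, seat `bsd-addord-k1-c2` gen 8; sequel of `…Desc3DoorTamDefect` p529837)

HONEST FRAMING. THEOREMS ONLY: no definition, no named fact, no `sorry`, nothing booked; BSD is not proved by any of this; the crux stays OPEN at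
class level. (1) `jWitness_three_of_intModel`: the second disjunct of the X4♯(3) image certificate `hcert` («`∃ q ≠ 3` prime, `ord_q j < 0`,
`3 ∤ ord_q j`») as a KERNEL certificate from four divisibility facts on the integral model (`v_q(c₄) = a`, `v_q(Δ) = b`, `3a < b`, `3 ∤ b`;
`j = c₄³/Δ` on the minimal model, n1011's `padicValRat_j_eq_of_intModel`). (2) The three Tamagawa-defect doors of p529837 with the lower-half
certificate line `hSel` REPLACED by an arbitrary `hlow : MissingLowerBoundAt W 3` (any producer: one `3`-descent Selmer element, a second-descent
DEEP witness as in bsd-potss K9's `K9Desc3.lower3_deep_<label>`, …): `bsdp_three_of_x4Cert_tamLocal_of_lower`,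
`bsdp_three_of_x4Cert_of_casselsTate_of_tamDefect_le_one_of_even_of_lower`, `bsdp_three_of_x4Cert_katoTam_of_lower` — twins of team n1011's
`X4RankZero.bsdp_three_of_cert_of_lower_maninFree_noL20` (which asks `3 ∤ ∏ c_ℓ`). Consumers: the DEEP records `…Desc3DeepRecords1–3`.
References: [Kato2004Asterisque] Thm. 14.5 (3) (p. 236), Prop. 14.16 (2) (p. 244), §14.8 (p. 238), Thm. 17.4 (3) (p. 273); [GreenbergLNM1716] §4
Prop. 4.13; [Delbourgo1998] Prop. 4 (p. 144); [SilvermanAEC2009] III.1, VII.1, Thm. X.4.14; [SilvermanATAEC1994] V.5.3; [Miller2011LMS] Def. 1.1.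
-/


set_option autoImplicit false

noncomputable section

open scoped Classical

open WeierstrassCurve Literature.NumberTheory.EllipticCurves
  Literature.NumberTheory.EllipticCurves.Rank1Residual
  Literature.NumberTheory.EllipticCurves.Rank1Residual.Typed
  Literature.NumberTheory.EllipticCurves.ModularForms
  Literature.NumberTheory.GaloisRepresentations
  Summit.BirchSwinnertonDyer.BirchSwinnertonDyer.Rank1Residual.IntModel

set_option linter.dupNamespace false

namespace Summit.BirchSwinnertonDyer.BirchSwinnertonDyer.Theorems.AdditiveBranchIMCGordTwoRankZeroDesc3

open Summit.BirchSwinnertonDyer.Rank1Residual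
open Summit.BirchSwinnertonDyer.Rank1Residual.Additive

/-! ### §0 Tools: a `j`-witness from divisibility certificates on the integral model; the `_of_lower` closers -/

/-- **A `j`-WITNESS from the integral model** (kernel certificate for the second disjunct of the X4♯(3) image certificate `hcert`): if
`integralModelInt W = E₀` and `q ≠ 3` is a prime with `v_q(c₄(E₀)) = a` and `v_q(Δ(E₀)) = b` (four divisibility facts, `decide`), `3a < b` and
`3 ∤ b`, then `ord_q j(W) = 3a − b < 0` and `3 ∤ ord_q j(W)` (`j = c₄³/Δ` on the minimal model, `padicValRat_j_eq_of_intModel`).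
[cite: SilvermanAEC2009, III.1 and VII.1] [cite: SilvermanATAEC1994, V.5.3 and Exercise 5.13(b) (PDF p. 416)] -/
theorem jWitness_three_of_intModel {W : WeierstrassCurve ℚ} [W.IsElliptic] [W.IsGloballyMinimal]
    {E₀ : WeierstrassCurve ℤ} (hI : integralModelInt W = E₀) (q : ℕ) [hq : Fact q.Prime] (hq3 : q ≠ 3)
    (a b : ℕ) (hca : (q : ℤ) ^ a ∣ E₀.c₄) (hca' : ¬ (q : ℤ) ^ (a + 1) ∣ E₀.c₄)
    (hΔb : (q : ℤ) ^ b ∣ E₀.Δ) (hΔb' : ¬ (q : ℤ) ^ (b + 1) ∣ E₀.Δ) (hlt : 3 * a < b) (hnd : ¬ 3 ∣ b) :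
    ∃ q : ℕ, q.Prime ∧ q ≠ 3 ∧ padicValRat q W.j < 0 ∧ ¬ (3 : ℤ) ∣ padicValRat q W.j := by
  have hc0 : E₀.c₄ ≠ 0 := fun h => hca' (h ▸ dvd_zero _)
  have hΔ0 : E₀.Δ ≠ 0 := fun h => hΔb' (h ▸ dvd_zero _)
  have hvc : padicValInt q E₀.c₄ = a := by
    apply le_antisymm
    · by_contra h
      exact hca' ((padicValInt_dvd_iff (a + 1) E₀.c₄).mpr (Or.inr (by omega)))
    · rcases (padicValInt_dvd_iff a E₀.c₄).mp hca with h | h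
      · exact absurd h hc0
      · exact h
  have hvΔ : padicValInt q E₀.Δ = b := by
    apply le_antisymm
    · by_contra h
      exact hΔb' ((padicValInt_dvd_iff (b + 1) E₀.Δ).mpr (Or.inr (by omega)))
    · rcases (padicValInt_dvd_iff b E₀.Δ).mp hΔb with h | h
      · exact absurd h hΔ0
      · exact h
  refine ⟨q, hq.out, hq3, ?_, ?_⟩
  · rw [padicValRat_j_eq_of_intModel hI q hc0, hvc, hvΔ]; omega
  · rw [padicValRat_j_eq_of_intModel hI q hc0, hvc, hvΔ]; omega

section OfLower

variable (W : WeierstrassCurve ℚ) [W.IsElliptic] [W.IsGloballyMinimal]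

/-- **`BSD(E,3)` on an X4♯(3) certified row from ANY lower half, Tamagawa `3`-part LOCAL AT `3`** (`ord₃ ∏ c_ℓ = v₃(c₃)`): the `_of_lower` form of
`bsdp_three_of_x4Cert_of_selmerGroup_ne_bot_tamLocal` — binders {hKato = A161′, hDel, hGZK, hmod, hmodD, hKatoω} + row data + `hlow : MissingLowerBoundAt W 3`
(any producer: a `3`-descent Selmer line, a second-descent deep witness, …). Twin of n1011's `X4RankZero.bsdp_three_of_cert_of_lower_maninFree_noL20`
(which asks `3 ∤ ∏ c_ℓ`). [cite: Kato2004Asterisque, Thm. 14.5 (3) (p. 236), Thm. 17.4 (3) (p. 273)] [cite: Delbourgo1998, Prop. 4 (p. 144)]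
[cite: Miller2011LMS, §1 and Def. 1.1] -/
theorem bsdp_three_of_x4Cert_tamLocal_of_lower
    (hKato : Kato2004.rankZero_padicValNat_sha_le_sub_localTamagawa_of_additive_potGood_of_imageContainsSL2_maninFree)
    (hDel : Delbourgo1998.prop4_rankZero_pow_dvd_constantCoeff)
    (hGZK : rank_eq_analyticRank_of_analyticRank_le_one) (hmod : hasEntireLFunction_rat)
    (hmodD : nonempty_modularParametrizationData)
    (hKatoω : Wuthrich2014.kato_minusEigenCharIdeal_dvd_cyclotomicThree_of_surjective)
    (hr : W.analyticRank = 0) (hX : ClassX4 W 3) (hsurj : Surj W 3)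
    (hcert : padicValRat 3 W.j < 0 ∨
      (∃ q : ℕ, q.Prime ∧ q ≠ 3 ∧ padicValRat q W.j < 0 ∧ ¬ (3 : ℤ) ∣ padicValRat q W.j) ∨
        W.HasSurjectiveModNGaloisRep 9)
    (htam : padicValNat 3 W.tamagawaProduct = padicValNat 3 ((W.baseChange ℚ_[3]).localTamagawaNumber ℤ_[3]))
    (hlow : MissingLowerBoundAt W 3) : BSDp W 3 :=
  haveI : Fact (Nat.Prime 3) := ⟨Nat.prime_three⟩
  bsdp_of_missingPPartAt W 3 hGZK (by rw [hr]; exact zero_le_one)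
    (missingPPartAt_of_lower_of_upper W 3 hlow
      (missingUpperBoundAt_three_of_x4Cert_tamLocal W hKato hDel hGZK hmod hmodD hKatoω hr hX hsurj hcert htam))

/-- **`BSD(E,3)` from ANY lower half on a Tamagawa-DEFECT-`≤ 1` row with `ord₃ #Ш_an` even** (Cassels–Tate parity): the `_of_lower` form of
`bsdp_three_of_x4Cert_of_selmerGroup_ne_bot_tamDefect_of_even`. [cite: Kato2004Asterisque, Thm. 14.5 (3) (p. 236), Prop. 14.16 (2) (p. 244)]
[cite: SilvermanAEC2009, Thm. X.4.14] [cite: Miller2011LMS, §1 and Def. 1.1] -/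
theorem bsdp_three_of_x4Cert_of_casselsTate_of_tamDefect_le_one_of_even_of_lower
    (hCT : exists_casselsTate_pairing (K := ℚ))
    (hKato : Kato2004.rankZero_padicValNat_sha_le_sub_localTamagawa_of_additive_potGood_of_imageContainsSL2_maninFree)
    (hDel : Delbourgo1998.prop4_rankZero_pow_dvd_constantCoeff)
    (hGZK : rank_eq_analyticRank_of_analyticRank_le_one) (hmod : hasEntireLFunction_rat)
    (hmodD : nonempty_modularParametrizationData)
    (hKatoω : Wuthrich2014.kato_minusEigenCharIdeal_dvd_cyclotomicThree_of_surjective)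
    (hr : W.analyticRank = 0) (hX : ClassX4 W 3) (hsurj : Surj W 3)
    (hcert : padicValRat 3 W.j < 0 ∨
      (∃ q : ℕ, q.Prime ∧ q ≠ 3 ∧ padicValRat q W.j < 0 ∧ ¬ (3 : ℤ) ∣ padicValRat q W.j) ∨
        W.HasSurjectiveModNGaloisRep 9)
    (htam : padicValNat 3 W.tamagawaProduct ≤ padicValNat 3 ((W.baseChange ℚ_[3]).localTamagawaNumber ℤ_[3]) + 1)
    {q : ℚ} (hq : shaAn W = (q : ℂ)) (heven : Even (padicValRat 3 q))
    (hlow : MissingLowerBoundAt W 3) : BSDp W 3 :=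
  haveI : Fact (Nat.Prime 3) := ⟨Nat.prime_three⟩
  bsdp_of_missingPPartAt W 3 hGZK (by rw [hr]; exact zero_le_one)
    (missingPPartAt_of_lower_of_upper W 3 hlow
      (missingUpperBoundAt_three_of_x4Cert_of_casselsTate_of_tamDefect_le_one_of_even W hCT hKato hDel hGZK hmod
        hmodD hKatoω hr hX hsurj hcert htam hq heven))

/-- **`BSD(E,3)` from ANY lower half, NO Tamagawa binder** (Tamagawa-exact reading A161″ = A305): the `_of_lower` form of
`bsdp_three_of_x4Cert_of_selmerGroup_ne_bot_katoTam`. [cite: Kato2004Asterisque, Thm. 14.5 (3) (p. 236), Prop. 14.16 (2) (p. 244), §14.8 (p. 238)]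
[cite: GreenbergLNM1716, §4 Prop. 4.13] [cite: Miller2011LMS, §1 and Def. 1.1] -/
theorem bsdp_three_of_x4Cert_katoTam_of_lower
    (hKatoT : Kato2004.rankZero_padicValNat_sha_add_padicValNat_tamagawa_le_of_additive_potGood_of_imageContainsSL2)
    (hDel : Delbourgo1998.prop4_rankZero_pow_dvd_constantCoeff)
    (hGZK : rank_eq_analyticRank_of_analyticRank_le_one) (hmod : hasEntireLFunction_rat)
    (hmodD : nonempty_modularParametrizationData)
    (hKatoω : Wuthrich2014.kato_minusEigenCharIdeal_dvd_cyclotomicThree_of_surjective)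
    (hr : W.analyticRank = 0) (hX : ClassX4 W 3) (hsurj : Surj W 3)
    (hcert : padicValRat 3 W.j < 0 ∨
      (∃ q : ℕ, q.Prime ∧ q ≠ 3 ∧ padicValRat q W.j < 0 ∧ ¬ (3 : ℤ) ∣ padicValRat q W.j) ∨
        W.HasSurjectiveModNGaloisRep 9)
    (hlow : MissingLowerBoundAt W 3) : BSDp W 3 :=
  haveI : Fact (Nat.Prime 3) := ⟨Nat.prime_three⟩
  bsdp_of_missingPPartAt W 3 hGZK (by rw [hr]; exact zero_le_one)
    (missingPPartAt_of_lower_of_upper W 3 hlow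
      (missingUpperBoundAt_three_of_x4Cert_katoTam W hKatoT hDel hGZK hmod hmodD hKatoω hr hX hsurj hcert))

end OfLower

end Summit.BirchSwinnertonDyer.BirchSwinnertonDyer.Theorems.AdditiveBranchIMCGordTwoRankZeroDesc3

end
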